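/-
Copyright: the b2b-balaban cell (near-miss cell 7), T⁴-continuum fan-out, lineage t4-ne7b-p3 (node U5c LARGE-DEVIATION
member P3).  Released under the licence of the surrounding project.
-/
import Summits.QuantumFields.BalabanUV.T4Continuum.Support.SpaceTimeConnector
import Summits.QuantumFields.BalabanUV.T4Continuum.Support.HistoryRealise
import Summits.QuantumFields.BalabanUV.T4Continuum.Support.HistorySlots

/-!
# Space-time Peierls ∕ Cramér route for NE7b — THE JUNCTION WITH THE COUNT SWARM's REALISED HISTORIES: every realised
# history (`HistoryRealise.Realises`) is a realised lineage of the CONTOUR route (`SkelOK`), and its domains sit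
# inside the route's S-evolved domains (`dom`) — so the cell binder holds on the COUNT carrier

Summits-side support leaf of the T⁴-continuum cell (rung (B)+1 on a FINITE torus only; NOT infinite volume, NOT the
mass gap, NOT the Clay statement; NOT a proof of the spine estimate NE7b).  Lineage `t4-ne7b-p3` (generation 2), node
U5c, skeleton `t4/skeletons/NE7b-t4-ne7b-p3.md` §9 (the instance of `SkelOK` on the COUNT swarm's carrier).  [folklore]
finite combinatorics composing this lineage's `SpaceTimeRealised` ∕ `SpaceTimeRealisedCells` ∕ `SpaceTimeConnector` with
the COUNT swarm's row-S1 ∕ S1b carriers `HistoryAdmissible.PGen` (p207789: the combinatorial skeleton with payload,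
canonical label `toGen`, `TypeNodup`, `Adm`) and `HistoryRealise.Realises` (p209120, leaf-08: the realised domains —
births as face-connected regions with `treeLen ≤ class`, renewals as `S`-images, joins of TOUCHING pending partners with
the joined domain inside the union) — all imported BY NAME, nothing modified; nothing printed is asserted (the
identification of Bałaban's terms with realised histories is the COUNT swarm's displayed H3); no `[cite:]` tag.

WHAT.  For a realised history `P : PGen (Pt d × Finset (Pt d))` (birth payload = `(anchor, region)`):
* §1 glue: `orbit = Siter` along the shifted ratios (`orbit_eq_Siter`), `Touch ↔ block`, `Siter` monotone, the domain
  shifts as one set along event-free stretches (`dom_shift`), pieces vanish off the events, and skeleton ∕ domain ∕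
  `SkelOK` depend on the pieces only through the events (`skel_congr`, `dom_congr`, `skelOK_congr`); chronology of the
  canonical label under `Adm` (`HistorySlots.step_le_lastStep_of_mem`, by name; `step_top_toGen`);
* §2 THE PIECES `pieceOf L s P : PEv → Finset ℤᵈ`: a birth label carries its region, a join label the CONNECTOR
  (`SpaceTimeConnector.connector`) about a skeleton point chosen by `Classical.epsilon`, a renewal label nothing;
* §3 **`skelOK_of_realises`**: `TypeNodup P → Adm K P → Realises L s R P Z → (∀ m, DropCtl s m) → 4 ≤ L →
  SkelOK (ratio L s) PEv.step (pieceOf L s P) PEv.fat (127^d + 3) P.toGen ∧ Z ⊆ dom … P.toGen P.lastStep` — by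
  induction on the history: births verbatim; renewals by the shift law; joins by the partners' touching images
  (print's merger criterion, as recorded by `Realises`) transported into `dom`, `SpaceTimeConnector.exists_skel_pair_of_touch`
  and `skel_merge_faceConnected`;
* §4 **`treeCells_le_of_realises`**: hence the CELL BINDER on the COUNT carrier — the realised structure-steps' cell
  counts `treeCells` are at most `8·126^d·treeD + 126^d·treeSteps` (`SpaceTimeRealisedCells.treeCells_le`).
Honest residue for the volume side of A2b after this file: ONLY the COUNT swarm's reading that Bałaban's live structures
ARE realised histories with these domains (H3 ∕ `RealisedDomains`), the flow's drop control, and `TypeNodup`.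

HONEST DEPENDENCY (cell, verbatim): continuum YM on T⁴ ⇐ BetaPertH ∧ nine spine estimates (0/9 proved); BetaPertH ⇐
(D1) ∧ (D4) ∧ CAP+tail; G-an2-4 gates asym, D1 and NE2/3/4.  This file changes none of it.
-/

open Finset

namespace Summit.QuantumFields.BalabanUV.T4Continuum.SpaceTimePeierls

open Literature.MathematicalPhysics.QuantumFieldTheory.Balaban1983to89
open Literature.MathematicalPhysics.QuantumFieldTheory.Balaban1983to89.B13ScaleTransfer
open Literature.MathematicalPhysics.QuantumFieldTheory.Balaban1983to89.TreeLength
open Literature.MathematicalPhysics.QuantumFieldTheory.Balaban1983to89.B16SProfile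
open Literature.MathematicalPhysics.QuantumFieldTheory.Balaban1983to89.B16MergeGeometry (Touch)
open T4PersistenceDictionary
open Summit.QuantumFields.BalabanUV.T4Continuum.HistoryAdmissible
open Summit.QuantumFields.BalabanUV.T4Continuum.HistoryRealise
open Summit.QuantumFields.BalabanUV.T4Continuum (HistorySlots.step_le_lastStep_of_mem)

noncomputable section

/-! ## §1 Glue -/

section Glue

variable {d : ℕ}

/-- the COUNT swarm's orbit is the S-iterate along the shifted ratio sequence [folklore] -/
theorem orbit_eq_Siter (L : ℕ) (s : ℕ → ℕ) (t₀ : ℕ) (Z : Finset (Pt d)) (l : ℕ) :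
    orbit L s t₀ Z l = Siter (fun i => ratio L s (t₀ + i)) l Z := by
  unfold orbit
  rw [ratio_shift]

/-- `iterAt` along the flow is the orbit [folklore] -/
theorem iterAt_eq_orbit (L : ℕ) (s : ℕ → ℕ) (t₀ n : ℕ) (Z : Finset (Pt d)) :
    iterAt (ratio L s) t₀ n Z = orbit L s t₀ Z (n - t₀) := by
  rw [orbit_eq_Siter]; rfl

/-- print's «touch» (`B16MergeGeometry.Touch`) is membership in the `3^d`-block [folklore] -/
theorem touch_iff_mem_block {a c : Pt d} : Touch a c ↔ c ∈ block a := by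
  rw [mem_block]
  unfold Touch
  constructor
  · intro h i; have := h i; constructor <;> omega
  · intro h i; have := h i; constructor <;> omega

/-- the S-iterates are monotone in the set [folklore] -/
theorem Siter_mono (q : ℕ → ℕ) {Z Z' : Finset (Pt d)} (h : Z ⊆ Z') : ∀ i, Siter q i Z ⊆ Siter q i Z'
  | 0 => h
  | i + 1 => by rw [Siter_succ, Siter_succ]; exact Sop_mono _ (Siter_mono q h i)

/-- shift of an S-iterate from its creation step to a later base step [folklore] -/
theorem iterAt_shift (q : ℕ → ℕ) {s t : ℕ} (hst : s ≤ t) (l : ℕ) (Z : Finset (Pt d)) :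
    iterAt q s (t + l) Z = Siter (fun i => q (t + i)) l (iterAt q s t Z) := by
  unfold iterAt
  rw [show t + l - s = (t - s) + l by omega, B16MergeHorizon.Siter_add]
  congr 1
  funext i
  rw [show s + (t - s + i) = t + i by omega]

variable {ε : Type*} [DecidableEq ε] {q : ℕ → ℕ} {step : ε → ℕ} {piece piece' : ε → Finset (Pt d)}

/-- **THE DOMAIN SHIFTS AS ONE SET** along event-free stretches: `dom V (t + l) = S^{l}(dom V t)` once every event of
`V` has happened by `t`. [folklore] -/
theorem dom_shift (G : Gen ε) {t : ℕ} (hG : ∀ e ∈ G.events, step e ≤ t) (l : ℕ) :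
    dom q step piece G (t + l) = Siter (fun i => q (t + i)) l (dom q step piece G t) := by
  unfold dom
  rw [Siter_biUnion]
  exact Finset.biUnion_congr rfl fun e he => iterAt_shift q (hG e he) l _

/-- skeletons depend on the pieces of the events only [folklore] -/
theorem skel_congr (G : Gen ε) (h : ∀ e ∈ G.events, piece e = piece' e) (n : ℕ) :
    skel q step piece G n = skel q step piece' G n :=
  Finset.biUnion_congr rfl fun e he => by rw [h e he]

/-- domains depend on the pieces of the events only [folklore] -/
theorem dom_congr (G : Gen ε) (h : ∀ e ∈ G.events, piece e = piece' e) (n : ℕ) :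
    dom q step piece G n = dom q step piece' G n :=
  Finset.biUnion_congr rfl fun e he => by rw [h e he]

/-- `SkelOK` depends on the pieces of the events only [folklore] -/
theorem skelOK_congr {fat : ε → ℕ} {dC : ℝ} :
    ∀ {G : Gen ε}, (∀ e ∈ G.events, piece e = piece' e) →
      SkelOK q step piece fat dC G → SkelOK q step piece' fat dC G
  | Gen.born b j, h, hok => by
      have hb : piece b = piece' b := h b (by simp)
      obtain ⟨h1, h2, h3, h4⟩ := hok
      exact ⟨h1, hb ▸ h2, hb ▸ h3, hb ▸ h4⟩
  | Gen.renew G e hh, h, hok => by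
      obtain ⟨hG, hpe, hse, hchron⟩ := hok
      have he : piece e = piece' e := h e (by simp)
      exact ⟨skelOK_congr (fun e' he' => h e' (by simp [he'])) hG, he ▸ hpe, hse, hchron⟩
  | Gen.merge X Y e, h, hok => by
      obtain ⟨hX, hY, hcX, hcY, hconn, hpc, hw⟩ := hok
      have he : piece e = piece' e := h e (by simp)
      refine ⟨skelOK_congr (fun e' he' => h e' (by simp [he'])) hX,
        skelOK_congr (fun e' he' => h e' (by simp [he'])) hY, hcX, hcY, ?_, he ▸ hpc, he ▸ hw⟩
      rw [← skel_congr (Gen.merge X Y e) h]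
      exact hconn

variable {γ : Type*}

/-- the structure appears at its last event: `step top = lastStep` [folklore] -/
theorem step_top_toGen : ∀ P : PGen γ, PEv.step P.toGen.top = P.lastStep
  | .birth _ _ _ => rfl
  | .renew _ _ => rfl
  | .join _ _ _ => rfl

end Glue

/-! ## §2 The pieces of a realised history -/

section Pieces

variable {d : ℕ}

/-- **THE PIECES** of a history with birth payload `(anchor, region)`, along the flow `(L, s)`: the label of a birth
carries its region; the label of a join carries the CONNECTOR about a skeleton point of the first partner within
radius `63` of the second partner's skeleton (chosen by `Classical.epsilon`; such a point exists whenever the partners'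
domains touch — `SpaceTimeConnector.exists_skel_pair_of_touch`); every other label carries nothing. [folklore] -/
def pieceOf (L : ℕ) (s : ℕ → ℕ) : PGen (Pt d × Finset (Pt d)) → PEv → Finset (Pt d)
  | .birth j cls zZ, e => if e = ((j, 0, cls) : PEv) then zZ.2 else ∅
  | .renew G _, e => pieceOf L s G e
  | .join X Y sj, e =>
      if e = ((sj, 2, 0) : PEv) then
        connector (Classical.epsilon fun c : Pt d =>
          c ∈ skel (ratio L s) PEv.step (pieceOf L s X) X.toGen sj ∧
            ∃ cY ∈ skel (ratio L s) PEv.step (pieceOf L s Y) Y.toGen sj, cY ∈ box c 63)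
      else pieceOf L s X e ∪ pieceOf L s Y e

variable {L : ℕ} {s : ℕ → ℕ}

/-- labels outside the history carry nothing [folklore] -/
theorem pieceOf_of_not_mem : ∀ (P : PGen (Pt d × Finset (Pt d))) {e : PEv}, e ∉ P.toGen.events → pieceOf L s P e = ∅
  | .birth j cls zZ, e, he => by
      simp only [PGen.toGen, Gen.events_born, mem_singleton] at he
      simp [pieceOf, he]
  | .renew G h, e, he => by
      simp only [PGen.toGen, Gen.events_renew, mem_insert, not_or] at he
      simp only [pieceOf]
      exact pieceOf_of_not_mem G he.2
  | .join X Y sj, e, he => by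
      simp only [PGen.toGen, Gen.events_merge, mem_insert, mem_union, not_or] at he
      simp only [pieceOf, if_neg he.1]
      rw [pieceOf_of_not_mem X he.2.1, pieceOf_of_not_mem Y he.2.2, empty_union]

end Pieces

/-! ## §3 Every realised history is a realised lineage of the contour route -/

section Main

variable {d : ℕ} {L : ℕ} {s R : ℕ → ℕ} {K : ℕ}

/-- **THE JUNCTION THEOREM.**  Along a flow with block size `L ≥ 4` and drop control on every horizon, a history `P`
with distinct event types (`TypeNodup`), observed by the cutoff (`Adm K`) and REALISED by the domain `Z` at its last
event (`HistoryRealise.Realises`) is a realised lineage of the CONTOUR route with the pieces `pieceOf L s P` and the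
connector constant `127^d + 3` — `SkelOK (ratio L s) PEv.step (pieceOf L s P) PEv.fat (127^d + 3) P.toGen` — and its
realised domain lies inside the route's S-evolved domain: `Z ⊆ dom … P.toGen P.lastStep`. [folklore] -/
theorem skelOK_of_realises (hL : 4 ≤ L) (hdrop : ∀ m, DropCtl s m) :
    ∀ {P : PGen (Pt d × Finset (Pt d))} {Z : Finset (Pt d)}, P.TypeNodup → P.Adm K → Realises L s R P Z →
      SkelOK (ratio L s) PEv.step (pieceOf L s P) PEv.fat ((127 : ℝ) ^ d + 3) P.toGen ∧
        Z ⊆ dom (ratio L s) PEv.step (pieceOf L s P) P.toGen P.lastStep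
  | .birth j cls zZ, Z, _, _, hRZ => by
      obtain ⟨hzZ, hz, hZc, hcls⟩ := hRZ
      have hpc : pieceOf L s (.birth j cls zZ) ((j, 0, cls) : PEv) = Z := by simp [pieceOf, hzZ]
      refine ⟨⟨rfl, ?_, ?_, ?_⟩, ?_⟩
      · rw [hpc]; exact ⟨_, hz⟩
      · rw [hpc]; exact hZc
      · rw [hpc]; simpa using hcls
      · -- `dom (born b j) j = piece b`
        intro x hx
        show x ∈ dom (ratio L s) PEv.step (pieceOf L s (.birth j cls zZ)) (Gen.born ((j, 0, cls) : PEv) j) j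
        unfold dom iterAt
        rw [Gen.events_born, singleton_biUnion, PEv.step_mk, Nat.sub_self, Siter_zero, hpc]
        exact hx
  | .renew G h, Z, hT, hA, hRZ => by
      obtain ⟨ZG, hRG, -, -, rfl⟩ := hRZ
      have hT' : ((h + 1, 1, 0) : PEv) ∉ G.evTypes ∧ G.TypeNodup := by
        simpa [PGen.TypeNodup, PGen.evTypes, Multiset.nodup_cons] using hT
      have hAG : G.Adm K := hA.1
      have hGl : G.lastStep ≤ h := hA.2.1
      obtain ⟨hok, hsub⟩ := skelOK_of_realises hL hdrop hT'.2 hAG hRG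
      have hnot : ((h + 1, 1, 0) : PEv) ∉ G.toGen.events := by
        rw [PGen.events_toGen, Multiset.mem_toFinset]; exact hT'.1
      have hpe : pieceOf L s (.renew G h) ((h + 1, 1, 0) : PEv) = ∅ := by
        simp only [pieceOf]; exact pieceOf_of_not_mem G hnot
      have hchron : ∀ e' ∈ G.toGen.events, PEv.step e' ≤ h + 1 := fun e' he' =>
        (HistorySlots.step_le_lastStep_of_mem hAG e' he').trans (by omega)
      refine ⟨⟨hok, hpe, rfl, hchron⟩, ?_⟩
      -- the renewed domain is the orbit of the old one; shift the inclusion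
      have hpe' : pieceOf L s G ((h + 1, 1, 0) : PEv) = ∅ := hpe
      show orbit L s G.lastStep ZG (h + 1 - G.lastStep) ⊆
        dom (ratio L s) PEv.step (pieceOf L s G) (Gen.renew G.toGen ((h + 1, 1, 0) : PEv) h) (h + 1)
      rw [dom_renew _ _ hpe', orbit_eq_Siter]
      have key : dom (ratio L s) PEv.step (pieceOf L s G) G.toGen (h + 1) =
          Siter (fun i => ratio L s (G.lastStep + i)) (h + 1 - G.lastStep)
            (dom (ratio L s) PEv.step (pieceOf L s G) G.toGen G.lastStep) := by
        have hs := dom_shift (q := ratio L s) (step := PEv.step) (piece := pieceOf L s G) G.toGen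
          (fun e' he' => HistorySlots.step_le_lastStep_of_mem hAG e' he') (h + 1 - G.lastStep)
        rwa [show G.lastStep + (h + 1 - G.lastStep) = h + 1 by omega] at hs
      rw [key]
      exact Siter_mono _ hsub _
  | .join X Y sj, Z, hT, hA, hRZ => by
      obtain ⟨ZX, ZY, hRX, hRY, htX, htY, -, -, ⟨a, ha, c, hc, hac⟩, hZ⟩ := hRZ
      have hT' : (((sj, 2, 0) : PEv) ∉ X.evTypes ∧ ((sj, 2, 0) : PEv) ∉ Y.evTypes) ∧ X.TypeNodup ∧ Y.TypeNodup ∧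
          Disjoint X.evTypes Y.evTypes := by
        simpa [PGen.TypeNodup, PGen.evTypes, Multiset.nodup_cons, Multiset.nodup_add] using hT
      obtain ⟨⟨hnX, hnY⟩, hTX, hTY, hdisj⟩ := hT'
      obtain ⟨hAX, hAY, -, -, hsK⟩ := hA
      obtain ⟨hokX, hsubX⟩ := skelOK_of_realises hL hdrop hTX hAX hRX
      obtain ⟨hokY, hsubY⟩ := skelOK_of_realises hL hdrop hTY hAY hRY
      have hlbl_X : ((sj, 2, 0) : PEv) ∉ X.toGen.events := by
        rw [PGen.events_toGen, Multiset.mem_toFinset]; exact hnX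
      have hlbl_Y : ((sj, 2, 0) : PEv) ∉ Y.toGen.events := by
        rw [PGen.events_toGen, Multiset.mem_toFinset]; exact hnY
      -- the combined pieces agree with the partners' pieces on their events
      have hagX : ∀ e ∈ X.toGen.events, (pieceOf L s X) e = (pieceOf L s (.join X Y sj)) e := by
        intro e he
        have hne : e ≠ ((sj, 2, 0) : PEv) := fun h => hlbl_X (h ▸ he)
        have heY : e ∉ Y.toGen.events := by
          intro h'
          rw [PGen.events_toGen, Multiset.mem_toFinset] at he h'
          exact Multiset.disjoint_left.1 hdisj he h'
        simp only [pieceOf, if_neg hne]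
        rw [pieceOf_of_not_mem Y heY, union_empty]
      have hagY : ∀ e ∈ Y.toGen.events, (pieceOf L s Y) e = (pieceOf L s (.join X Y sj)) e := by
        intro e he
        have hne : e ≠ ((sj, 2, 0) : PEv) := fun h => hlbl_Y (h ▸ he)
        have heX : e ∉ X.toGen.events := by
          intro h'
          rw [PGen.events_toGen, Multiset.mem_toFinset] at he h'
          exact Multiset.disjoint_left.1 hdisj h' he
        simp only [pieceOf, if_neg hne]
        rw [pieceOf_of_not_mem X heX, empty_union]
      -- chronology
      have hcX : ∀ e ∈ X.toGen.events, PEv.step e ≤ sj := fun e he => (HistorySlots.step_le_lastStep_of_mem hAX e he).trans htX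
      have hcY : ∀ e ∈ Y.toGen.events, PEv.step e ≤ sj := fun e he => (HistorySlots.step_le_lastStep_of_mem hAY e he).trans htY
      -- the partners' images at the join step lie inside the route's domains
      have hdomX : orbit L s X.lastStep ZX (sj - X.lastStep) ⊆ dom (ratio L s) PEv.step (pieceOf L s X) X.toGen sj := by
        rw [orbit_eq_Siter]
        have key : dom (ratio L s) PEv.step (pieceOf L s X) X.toGen sj =
            Siter (fun i => ratio L s (X.lastStep + i)) (sj - X.lastStep)
              (dom (ratio L s) PEv.step (pieceOf L s X) X.toGen X.lastStep) := by
          have hs := dom_shift (q := ratio L s) (step := PEv.step) (piece := (pieceOf L s X)) X.toGen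
            (fun e he => HistorySlots.step_le_lastStep_of_mem hAX e he) (sj - X.lastStep)
          rwa [show X.lastStep + (sj - X.lastStep) = sj by omega] at hs
        rw [key]
        exact Siter_mono _ hsubX _
      have hdomY : orbit L s Y.lastStep ZY (sj - Y.lastStep) ⊆ dom (ratio L s) PEv.step (pieceOf L s Y) Y.toGen sj := by
        rw [orbit_eq_Siter]
        have key : dom (ratio L s) PEv.step (pieceOf L s Y) Y.toGen sj =
            Siter (fun i => ratio L s (Y.lastStep + i)) (sj - Y.lastStep)
              (dom (ratio L s) PEv.step (pieceOf L s Y) Y.toGen Y.lastStep) := by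
          have hs := dom_shift (q := ratio L s) (step := PEv.step) (piece := (pieceOf L s Y)) Y.toGen
            (fun e he => HistorySlots.step_le_lastStep_of_mem hAY e he) (sj - Y.lastStep)
          rwa [show Y.lastStep + (sj - Y.lastStep) = sj by omega] at hs
        rw [key]
        exact Siter_mono _ hsubY _
      -- the skeleton pair from the touching images (read with the combined pieces, then transported back)
      have hL3 : 3 ≤ L := by omega
      obtain ⟨cX, hcXm, cY, hcYm, hnear⟩ := exists_skel_pair_of_touch (piece := pieceOf L s (.join X Y sj)) hL3
        (hdrop sj) X.toGen Y.toGen hcX hcY le_rfl (by rw [← dom_congr X.toGen hagX]; exact hdomX ha)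
        (by rw [← dom_congr Y.toGen hagY]; exact hdomY hc) (touch_iff_mem_block.1 hac)
      -- the chosen centre
      let spec : Pt d → Prop := fun c0 =>
        c0 ∈ skel (ratio L s) PEv.step (pieceOf L s X) X.toGen sj ∧ ∃ cY ∈ skel (ratio L s) PEv.step (pieceOf L s Y) Y.toGen sj, cY ∈ box c0 63
      have hspec : spec (Classical.epsilon spec) :=
        Classical.epsilon_spec ⟨cX, by
          refine ⟨?_, cY, ?_, hnear⟩
          · rw [skel_congr X.toGen hagX]; exact hcXm
          · rw [skel_congr Y.toGen hagY]; exact hcYm⟩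
      obtain ⟨hc₀, cY', hcY', hnear'⟩ := hspec
      have hpe : (pieceOf L s (.join X Y sj)) ((sj, 2, 0) : PEv) = connector (Classical.epsilon spec) := by
        simp only [pieceOf, if_true]
        rfl
      -- the partners' skeletons at the join step are face-connected
      have hL0 : 0 < L := by omega
      have hdC : (0 : ℝ) ≤ (127 : ℝ) ^ d + 3 := by positivity
      obtain ⟨-, hXfc, -⟩ := treeLen_skel_le (ratio_pos hL0 s) hdC hokX (n := sj)
        (by rw [step_top_toGen]; exact htX)
      obtain ⟨-, hYfc, -⟩ := treeLen_skel_le (ratio_pos hL0 s) hdC hokY (n := sj)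
        (by rw [step_top_toGen]; exact htY)
      -- assemble the merge clause
      have hconn : FaceConnected
          (skel (ratio L s) PEv.step (pieceOf L s (.join X Y sj)) (Gen.merge X.toGen Y.toGen (sj, 2, 0)) sj) :=
        skel_merge_faceConnected (q := ratio L s) (piece := pieceOf L s (.join X Y sj))
          (by rw [← skel_congr X.toGen hagX]; exact hXfc) (by rw [← skel_congr Y.toGen hagY]; exact hYfc)
          (by rw [← skel_congr X.toGen hagX]; exact hc₀) (by rw [← skel_congr Y.toGen hagY]; exact hcY')
          hnear' hpe
      refine ⟨⟨skelOK_congr hagX hokX, skelOK_congr hagY hokY, hcX, hcY, hconn,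
        (connector_clause hpe le_rfl).1, (connector_clause hpe le_rfl).2⟩, ?_⟩
      -- the joined domain lies inside the union of the partners' images, hence inside `dom`
      simp only [PGen.toGen, PGen.lastStep]
      rw [dom_merge]
      intro x hx
      rcases mem_union.1 (hZ hx) with hx | hx
      · exact mem_union_right _ (mem_union_left _ (by rw [← dom_congr X.toGen hagX]; exact hdomX hx))
      · exact mem_union_right _ (mem_union_right _ (by rw [← dom_congr Y.toGen hagY]; exact hdomY hx))

/-! ## §4 The cell binder on the COUNT carrier -/

/-- **THE CELL BINDER FOR REALISED HISTORIES.**  For a realised history as above and every cut `t`, the realised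
structure-steps' cell counts of the CONTOUR route obey
`treeCells … P.toGen t ≤ 8·126^d · treeD PEv.fat PEv.step (127^d + 3) P.toGen t + 126^d · treeSteps PEv.step P.toGen t`
— the `hvol` binder of `SpaceTimeVolume.volumeAccounting_ledgerOfGen` (`cA = 8·126^d`, `cB = 126^d`, `dC = 127^d + 3`),
for a contour read as the union of the structure-steps' domains `dom`. [folklore] -/
theorem treeCells_le_of_realises (hL : 4 ≤ L) (hdrop : ∀ m, DropCtl s m) {P : PGen (Pt d × Finset (Pt d))}
    {Z : Finset (Pt d)} (hT : P.TypeNodup) (hA : P.Adm K) (hRZ : Realises L s R P Z) (t : ℕ) :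
    treeCells (ratio L s) PEv.step (pieceOf L s P) P.toGen t ≤
      8 * 126 ^ d * treeD PEv.fat PEv.step ((127 : ℝ) ^ d + 3) P.toGen t +
        126 ^ d * treeSteps PEv.step P.toGen t :=
  treeCells_le hL (hdrop t) (by positivity) (skelOK_of_realises hL hdrop hT hA hRZ).1 (Nat.le_succ t)

end Main

end

end Summit.QuantumFields.BalabanUV.T4Continuum.SpaceTimePeierls
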